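import Literature.NumberTheory.EllipticCurves.PAdicLFunctionInvolutionProofs
import Literature.NumberTheory.EllipticCurves.PAdicLFunctionFrickeSymmetryProofs
import Literature.NumberTheory.EllipticCurves.PlusMinusPAdicLFunction
import HarnessLib

/-!
# The functional equation of the Mazur–Tate elements `θ_n`
# (cell `b2b-bsdres`, supersingular family, prover B = unit `b2b-bsdres-additive-p3`, gen 5; part 1/2)

HONEST FRAMING (run/shared/lean/b2b/bsd-rank1-residual/, verbatim in every file): the goal of the
cell is to DELETE the COMBINATION-SHAPED residual classes of the Birch–Swinnerton-Dyer formula for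
ALL analytic-rank `≤ 1` elliptic curves over `ℚ` — "full BSD formula for every rank `≤ 1` curve in
class `C`" assembled STRICTLY from published theorems — so that the rank-`≤ 1` remainder becomes
exactly the CONSTRUCTION-SHAPED classes, which are TYPED (missing-input `Prop`s), NOT attempted.
This is not "finishing BSD". THEOREMS ONLY (no definition, no named fact; nothing about any curve is
asserted; nothing booked; labels unchanged).

## What this file proves

For a cusp form `f ∈ S₂(Γ₀(N))` with the pointwise Fricke eigen-property
`f(-1/(Nτ)) = -σ N τ² f(τ)`, `σ = ±1` (`ModularForms.IsFrickeEigen N f (-σ)`; for the newform of an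
elliptic curve `σ = -ε_N(f) = w_E`), a prime `p ∤ N` and a layer `n`, the Mazur–Tate element
`θ_n(f, T) = ∑_{a ∈ (ℤ/p^{n+e₀})ˣ} [a/p^{n+e₀}]⁺_f (1+T)^{s(a)}` (`mazurTateElement f p n ∈ ℚ[T]`,
`a = η γ^{s(a)}`, `s(a) ∈ [0, pⁿ)`; Pollack 2003, Def. 6.15) satisfies the FUNCTIONAL EQUATION of the
Mazur–Tate modular elements (Mazur–Tate, *Refined conjectures of the "Birch and Swinnerton-Dyer
type"*, Duke Math. J. 54 (1987); in print in the form used here as Ota, Amer. J. Math. 140 (2018),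
Prop. 5.16: "`θ_S = ε_f δ_{−N}^{−1} ι(θ_S)`", `ι(σ) = σ^{−1}` on `G_S`, `w_N(f) = −ε_f f`,
`ε_f = (−1)^{ord_{s=1} L(E,s)}`, from the symbol relation "`[a/S]^±_E = ε_f [a'/S]^±_E` where
`a' a N ≡ −1 mod S`"), in the `T`-variable of the layer-`n` quotient `G_{p^{n+e₀}} ↠ Γ_n`:

* `mazurTateElement_eq_mul_reflect` — **`θ_n(T) = σ · ∑_a [a/p^{n+e₀}]⁺ (1+T)^{(c − s(a)) mod pⁿ}`**
  where `N = η_N γ^{-c}` (`c = -s_N`): the reflection `a ↦ a' = -1/(Na)` of `(ℤ/p^{n+e₀})ˣ` carries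
  `s(a) ↦ -s_N - s(a)` and `[a]⁺ = σ [a']⁺` (Fricke symmetry of the plus symbols,
  `IsFrickeEigen.normalizedPlusSymbol_div_eq_mul` + `ratPlusSymbol_eq_mul_of_normalizedPlusSymbol_eq`,
  reindexed by `finsum_sum_classes_eq_mul_of_symmetry` — the tree's layers 1–2 of the functional
  equation of `L_p(f, α, T)`, Mazur–Tate–Teitelbaum 1986, §I.17, which need NO `α`: they act on the
  Riemann sums, i.e. on `θ_n` itself);
* `cyclotomicOmega_dvd_mazurTateElement_sub` — **`θ_n(T) ≡ σ (1+T)^c θ_n((1+T)^{-1} − 1) (mod ω_n)`**,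
  written without inverses as `ω_n ∣ θ_n − σ (X+1)^c · θ_n ∘ ((X+1)^{pⁿ−1} − 1)` in `ℚ[X]`
  (`(1+T)^{-1} ≡ (1+T)^{pⁿ−1} (mod ω_n)`), and the `∃ c` packaging
  `exists_cyclotomicOmega_dvd_mazurTateElement_sub` (hypotheses: `IsFrickeEigen N f (-σ)`, `σ² = 1`,
  `p ∤ N`; any prime `p`, any reduction type, any `a_p`).

Part 2 (`MazurTateParity.lean`) draws the consequence for the Iwasawa invariants:
`(−1)^{λ(θ_n)} = σ` whenever `μ(θ_n) = 0`, hence `λ(L♯) ≡ λ(L♭) ≡ λ(L^±) ≡ ord_{s=1} L(E, s) (mod 2)`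
for the supersingular signed `p`-adic `L`-functions of the cell.

References: [Ota2018] K. Ota, Amer. J. Math. 140 (2018) 495–542 = arXiv:1509.00682, §5.5,
Prop. 5.16 (functional equation of Mazur–Tate elements) and the display before it (symbol relation);
[MazurTate1987] B. Mazur, J. Tate, Duke Math. J. 54 (1987) 711–750 (the modular elements and their
functional equation); [MazurTateTeitelbaum1986Invent] §I.10, §I.13, §I.17; [Pollack2003] Def. 6.15,
Rem. 6.16; [GreenbergLNM1716] §1, pp. 67–68. Memo: `HOME/b2b-bsdres-additive-p3/X8-ROUTE-B.md` §10 (gen 5).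
-/

set_option autoImplicit false

noncomputable section

open scoped Classical MatrixGroups ModularForm

open CongruenceSubgroup Polynomial Literature.NumberTheory.EllipticCurves
  Literature.NumberTheory.EllipticCurves.ModularForms

namespace Summit.BirchSwinnertonDyer.Rank1Residual.Supersingular

variable {N : ℕ} [NeZero N] {f : CuspForm (Gamma0 N) 2} {p : ℕ} [hp : Fact p.Prime]

/-! ## §1. Fricke symmetry of the weights `a ↦ [a/p^L]⁺` on `ℤ/p^L` -/

/-- **`[u/p^L]⁺ = σ [u'/p^L]⁺` whenever `N u u' ≡ −1 (mod p^L)`**, `L ≥ 1`, for the rational plus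
symbols of a form with `f(-1/(Nτ)) = -σ N τ² f(τ)`, `σ² = 1` (any `L`; for `L = 0` the
hypothesis is vacuous unless `N u u' = -1` holds in the zero ring, where the conclusion is formal): the representatives `a = u.val`,
`b = u'.val` satisfy `A p^L − a N b = 1` for some `A ∈ ℤ`, so the Fricke symmetry of the plus symbols
(`IsFrickeEigen.normalizedPlusSymbol_div_eq_mul`) applies and passes to the rational symbols
(`ratPlusSymbol_eq_mul_of_normalizedPlusSymbol_eq`). (The `α`-free core of
`msdMeasure_eq_mul_of_isFrickeEigen`; Ota 2018, display before Prop. 5.16: "`[a/S]^± = ε_f [a'/S]^±`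
where `a' a N ≡ −1 mod S`".) [cite: Ota2018, §5.5 (display before Prop. 5.16)]
[cite: MazurTateTeitelbaum1986Invent, §I.17] -/
theorem ratPlusSymbol_val_div_eq_mul_of_isFrickeEigen {σ : ℤ} (hσ : σ ^ 2 = 1)
    (hW : IsFrickeEigen N f (-(σ : ℂ))) {L : ℕ} {u u' : ZMod (p ^ L)}
    (h : (N : ZMod (p ^ L)) * u * u' = -1) :
    ratPlusSymbol f ((u.val : ℚ) / (p : ℚ) ^ L) = σ * ratPlusSymbol f ((u'.val : ℚ) / (p : ℚ) ^ L) := by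
  haveI : NeZero (p ^ L) := ⟨pow_ne_zero _ hp.out.ne_zero⟩
  have hdvd : ((p ^ L : ℕ) : ℤ) ∣ (N : ℤ) * u.val * u'.val + 1 := by
    rw [← ZMod.intCast_zmod_eq_zero_iff_dvd]
    push_cast
    rw [ZMod.natCast_zmod_val, ZMod.natCast_zmod_val, h, neg_add_cancel]
  obtain ⟨A, hA⟩ := hdvd
  have h1 : A * ((p ^ L : ℕ) : ℤ) - (u.val : ℤ) * (N * (u'.val : ℤ)) = 1 := by
    linear_combination -hA
  have k := ratPlusSymbol_eq_mul_of_normalizedPlusSymbol_eq f hσ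
    (hW.normalizedPlusSymbol_div_eq_mul hσ (pow_pos hp.out.pos L) h1)
  have hcast : (((p ^ L : ℕ) : ℚ)) = (p : ℚ) ^ L := by push_cast; rfl
  rw [hcast] at k
  exact k

/-! ## §2. The functional equation, reflected-sum form -/

/-- **Functional equation of `θ_n`, reflected-sum form** (Ota 2018, Prop. 5.16
"`θ_S = ε_f δ_{−N}^{−1} ι(θ_S)`" for `S = p^{n+e₀}`, pushed to the layer-`n` variable `T`; Mazur–Tate
1987; Mazur–Tate–Teitelbaum 1986, §I.17 at finite level). Let `f ∈ S₂(Γ₀(N))` satisfy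
`f(-1/(Nτ)) = -σ N τ² f(τ)` with `σ² = 1`, let `p` be a prime and write the level as a class
`N ≡ η_N γ^{s_N} (mod p^{n+e₀})` (`exists_classMap_eq_natCast`, `p ∤ N`). Then
`θ_n(f, T) = σ · ∑_{η, s} [η γ^s / p^{n+e₀}]⁺_f (1+T)^{(−s_N − s) mod pⁿ}`: the involution
`a ↦ −1/(Na)` of `(ℤ/p^{n+e₀})ˣ` reindexes the Riemann sum defining `θ_n`
(`finsum_sum_classes_eq_mul_of_symmetry`) and multiplies each weight by `σ`
(`ratPlusSymbol_val_div_eq_mul_of_isFrickeEigen`). [cite: Ota2018, Prop. 5.16]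
[cite: MazurTateTeitelbaum1986Invent, §I.17] -/
theorem mazurTateElement_eq_mul_reflect {σ : ℤ} (hσ : σ ^ 2 = 1)
    (hW : IsFrickeEigen N f (-(σ : ℂ))) (n : ℕ)
    {ηN : rootsOfUnity (torsionOrder p) ℤ_[p]} {sN : ZMod (p ^ n)}
    (hN : PadicInt.toZModPow (n + cyclotomicExponent p) ((ηN : ℤ_[p]ˣ) : ℤ_[p]) *
        (cyclotomicGenerator p : ZMod (p ^ (n + cyclotomicExponent p))) ^ sN.val =
          (N : ZMod (p ^ (n + cyclotomicExponent p)))) :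
    mazurTateElement f p n = C (σ : ℚ) *
      ∑ᶠ η : rootsOfUnity (torsionOrder p) ℤ_[p], ∑ s : ZMod (p ^ n),
        C (ratPlusSymbol f
            (((PadicInt.toZModPow (n + cyclotomicExponent p) ((η : ℤ_[p]ˣ) : ℤ_[p]) *
                  (cyclotomicGenerator p : ZMod (p ^ (n + cyclotomicExponent p))) ^ s.val).val : ℚ) /
              (p : ℚ) ^ (n + cyclotomicExponent p))) *
          (X + 1) ^ (-sN - s).val := by
  have hw : ∀ u u' : ZMod (p ^ (n + cyclotomicExponent p)),
      (N : ZMod (p ^ (n + cyclotomicExponent p))) * u * u' = -1 →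
        C (ratPlusSymbol f ((u.val : ℚ) / (p : ℚ) ^ (n + cyclotomicExponent p))) =
          C (σ : ℚ) * C (ratPlusSymbol f ((u'.val : ℚ) / (p : ℚ) ^ (n + cyclotomicExponent p))) := by
    intro u u' h
    rw [← C_mul, ratPlusSymbol_val_div_eq_mul_of_isFrickeEigen hσ hW h]
  have key := finsum_sum_classes_eq_mul_of_symmetry p n hw hN (fun s ↦ ((X + 1 : ℚ[X]) ^ s.val))
  rw [mazurTateElement]
  exact key

/-! ## §3. The functional equation as a congruence modulo `ω_n` -/

omit hp in
/-- `ω_n = (X+1)^{pⁿ} − 1` divides `(X+1)^a − (X+1)^b` whenever `a ≡ b (mod pⁿ)` (here `b ≤ a`).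
[folklore] -/
theorem cyclotomicOmega_map_dvd_pow_sub_pow {R : Type*} [CommRing R] (n : ℕ) {a b : ℕ} (hba : b ≤ a)
    (hab : p ^ n ∣ a - b) :
    (cyclotomicOmega p n).map (Int.castRingHom R) ∣ ((X + 1 : R[X]) ^ a - (X + 1) ^ b) := by
  obtain ⟨k, hk⟩ := hab
  have ha : a = b + p ^ n * k := by omega
  have hω : (cyclotomicOmega p n).map (Int.castRingHom R) = (X + 1 : R[X]) ^ p ^ n - 1 := by
    simp [cyclotomicOmega]
  rw [hω, ha, pow_add, pow_mul]
  have h1 : ((X + 1 : R[X]) ^ p ^ n - 1) ∣ (((X + 1 : R[X]) ^ p ^ n) ^ k - 1 ^ k) :=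
    sub_dvd_pow_sub_pow _ _ k
  rw [one_pow] at h1
  have h2 : (X + 1 : R[X]) ^ b * ((X + 1) ^ p ^ n) ^ k - (X + 1) ^ b =
      (X + 1) ^ b * (((X + 1) ^ p ^ n) ^ k - 1) := by ring
  rw [h2]
  exact Dvd.dvd.mul_left h1 _

/-- **Functional equation of `θ_n` modulo `ω_n`** (Ota 2018, Prop. 5.16 in the `T`-variable;
Mazur–Tate 1987; Mazur–Tate–Teitelbaum 1986, §I.17 at finite level): with `f`, `σ`, `p`, `η_N`, `s_N` as in `mazurTateElement_eq_mul_reflect`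
and `c = (−s_N) mod pⁿ`,
`ω_n ∣ θ_n(T) − σ · (1+T)^c · θ_n((1+T)^{pⁿ−1} − 1)` in `ℚ[T]`, i.e.
`θ_n(T) ≡ σ (1+T)^c θ_n((1+T)^{−1} − 1) (mod ω_n)` — the involution `γ ↦ γ^{−1}` of
`ℚ[Γ_n] = ℚ[T]/(ω_n)` composed with the group-like element `γ^c = ⟨N⟩^{−1}|_{Γ_n}`.
Termwise: `(1+T)^c · ((1+T)^{pⁿ−1})^{s} ≡ (1+T)^{(c − s) mod pⁿ}` (`cyclotomicOmega_map_dvd_pow_sub_pow`).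
[cite: Ota2018, Prop. 5.16] [cite: MazurTateTeitelbaum1986Invent, §I.17] -/
theorem cyclotomicOmega_dvd_mazurTateElement_sub {σ : ℤ} (hσ : σ ^ 2 = 1)
    (hW : IsFrickeEigen N f (-(σ : ℂ))) (n : ℕ)
    {ηN : rootsOfUnity (torsionOrder p) ℤ_[p]} {sN : ZMod (p ^ n)}
    (hN : PadicInt.toZModPow (n + cyclotomicExponent p) ((ηN : ℤ_[p]ˣ) : ℤ_[p]) *
        (cyclotomicGenerator p : ZMod (p ^ (n + cyclotomicExponent p))) ^ sN.val =
          (N : ZMod (p ^ (n + cyclotomicExponent p)))) :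
    (cyclotomicOmega p n).map (Int.castRingHom ℚ) ∣
      mazurTateElement f p n -
        C (σ : ℚ) * ((X + 1) ^ (-sN).val *
          (mazurTateElement f p n).comp ((X + 1) ^ (p ^ n - 1) - 1)) := by
  haveI := neZero_torsionOrder p
  haveI := Fintype.ofFinite (rootsOfUnity (torsionOrder p) ℤ_[p])
  haveI : NeZero (p ^ n) := ⟨pow_ne_zero _ hp.out.ne_zero⟩
  set P : ℚ[X] := (X + 1) ^ (p ^ n - 1) - 1 with hP
  set w : rootsOfUnity (torsionOrder p) ℤ_[p] → ZMod (p ^ n) → ℚ := fun η s ↦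
    ratPlusSymbol f
      (((PadicInt.toZModPow (n + cyclotomicExponent p) ((η : ℤ_[p]ˣ) : ℤ_[p]) *
            (cyclotomicGenerator p : ZMod (p ^ (n + cyclotomicExponent p))) ^ s.val).val : ℚ) /
        (p : ℚ) ^ (n + cyclotomicExponent p)) with hw
  -- the reflected form of `θ_n` and the composed form, as finite sums
  have hrefl : mazurTateElement f p n =
      C (σ : ℚ) * ∑ η : rootsOfUnity (torsionOrder p) ℤ_[p], ∑ s : ZMod (p ^ n),
        C (w η s) * (X + 1) ^ (-sN - s).val := by
    rw [mazurTateElement_eq_mul_reflect hσ hW n hN, finsum_eq_sum_of_fintype]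
  have hθ : mazurTateElement f p n =
      ∑ η : rootsOfUnity (torsionOrder p) ℤ_[p], ∑ s : ZMod (p ^ n), C (w η s) * (X + 1) ^ s.val := by
    rw [mazurTateElement, finsum_eq_sum_of_fintype]
  have hcomp : (X + 1 : ℚ[X]) ^ (-sN).val * (mazurTateElement f p n).comp P =
      ∑ η : rootsOfUnity (torsionOrder p) ℤ_[p], ∑ s : ZMod (p ^ n),
        C (w η s) * (X + 1) ^ ((-sN).val + (p ^ n - 1) * s.val) := by
    rw [hθ, Polynomial.sum_comp, Finset.mul_sum]
    refine Finset.sum_congr rfl fun η _ ↦ ?_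
    rw [Polynomial.sum_comp, Finset.mul_sum]
    refine Finset.sum_congr rfl fun s _ ↦ ?_
    have hP1 : P + 1 = (X + 1) ^ (p ^ n - 1) := by rw [hP]; ring
    rw [mul_comp, C_comp, pow_comp, add_comp, X_comp, one_comp, hP1, ← pow_mul, pow_add]
    ring
  -- termwise congruence
  have hterm : ∀ (η : rootsOfUnity (torsionOrder p) ℤ_[p]) (s : ZMod (p ^ n)),
      (cyclotomicOmega p n).map (Int.castRingHom ℚ) ∣
        C (w η s) * (X + 1) ^ (-sN - s).val -
          C (w η s) * (X + 1) ^ ((-sN).val + (p ^ n - 1) * s.val) := by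
    intro η s
    rw [← mul_sub]
    refine Dvd.dvd.mul_left ?_ _
    -- `b = (-sN - s).val ≤ a = (-sN).val + (pⁿ - 1) s.val` and `a ≡ b (mod pⁿ)`
    have hpn : 1 ≤ p ^ n := Nat.one_le_pow _ _ hp.out.pos
    have hb : (-sN - s).val < p ^ n := ZMod.val_lt _
    have hba : (-sN - s).val ≤ (-sN).val + (p ^ n - 1) * s.val := by
      by_cases hs : s.val = 0
      · have hs0 : s = 0 := (ZMod.val_eq_zero s).mp hs
        rw [hs0, sub_zero, ZMod.val_zero, mul_zero, add_zero]
      · have h1 : 1 ≤ s.val := Nat.one_le_iff_ne_zero.mpr hs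
        calc (-sN - s).val ≤ p ^ n - 1 := by omega
          _ ≤ (p ^ n - 1) * s.val := Nat.le_mul_of_pos_right _ h1
          _ ≤ (-sN).val + (p ^ n - 1) * s.val := Nat.le_add_left _ _
    have hmod : p ^ n ∣ ((-sN).val + (p ^ n - 1) * s.val) - (-sN - s).val := by
      refine (Nat.modEq_iff_dvd' hba).mp ?_
      rw [← ZMod.natCast_eq_natCast_iff]
      push_cast
      rw [ZMod.natCast_zmod_val, ZMod.natCast_zmod_val, ZMod.natCast_zmod_val, Nat.cast_sub hpn,
        ZMod.natCast_self]
      ring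
    have h := cyclotomicOmega_map_dvd_pow_sub_pow (R := ℚ) (p := p) n hba hmod
    rwa [← neg_sub, dvd_neg] at h
  rw [hcomp, hrefl, Finset.mul_sum, Finset.mul_sum, ← Finset.sum_sub_distrib]
  refine Finset.dvd_sum fun η _ ↦ ?_
  rw [Finset.mul_sum, Finset.mul_sum, ← Finset.sum_sub_distrib]
  refine Finset.dvd_sum fun s _ ↦ ?_
  rw [← mul_sub]
  exact Dvd.dvd.mul_left (hterm η s) _

/-- **Functional equation of `θ_n`, packaged**: for `f ∈ S₂(Γ₀(N))` with
`f(-1/(Nτ)) = -σ N τ² f(τ)`, `σ² = 1`, and a prime `p ∤ N`, there is `c < pⁿ` (namely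
`γ^c = ⟨N⟩^{-1}` on `Γ_n`) with `ω_n ∣ θ_n(T) − σ (1+T)^c θ_n((1+T)^{pⁿ−1} − 1)` in `ℚ[T]`.
[cite: Ota2018, Prop. 5.16] [cite: MazurTateTeitelbaum1986Invent, §I.17] -/
theorem exists_cyclotomicOmega_dvd_mazurTateElement_sub {σ : ℤ} (hσ : σ ^ 2 = 1)
    (hW : IsFrickeEigen N f (-(σ : ℂ))) (hpN : ¬ p ∣ N) (n : ℕ) :
    ∃ c : ℕ, c < p ^ n ∧ (cyclotomicOmega p n).map (Int.castRingHom ℚ) ∣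
      mazurTateElement f p n -
        C (σ : ℚ) * ((X + 1) ^ c * (mazurTateElement f p n).comp ((X + 1) ^ (p ^ n - 1) - 1)) := by
  haveI : NeZero (p ^ n) := ⟨pow_ne_zero _ hp.out.ne_zero⟩
  obtain ⟨ηN, sN, hN⟩ := exists_classMap_eq_natCast p n hpN
  exact ⟨(-sN).val, ZMod.val_lt _, cyclotomicOmega_dvd_mazurTateElement_sub hσ hW n hN⟩

end Summit.BirchSwinnertonDyer.Rank1Residual.Supersingular

end
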